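import Summits.QuantumFields.BalabanUV.Beta.GAN24.BlockFluxMass
import Summits.QuantumFields.BalabanUV.Beta.GAN24.BlockFluxTower

/-!
# `BalabanUV.Beta.GAN24.BlockFluxMassTower` — binder row G-an2-4 ∕ (CONV-C), CT-W (route «WC-TL» ∕ (Q-R) «QR-LL», the (DIV) display of RULING R-gan24p1-g29-2):
# **THE FLUX TOWER IN TOTAL-MASS (ℓ¹) CURRENCY — THE TOTAL MASS OF THE TRANSPORTED LETTER's FLUX IS AT MOST `(∏_{j} g_j)` TIMES THE BOTTOM MASS,
# `g_j := |c_j·c_{H,j}|·|Fib d|⁴·C_j²·Z_{δ_j}²` — KERNEL-ONLY, NO REFINEMENT MULTIPLICITY, NO RATE RESCALING**: the one-level ℓ¹ gain of `GAN24/BlockFluxMass`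
# re-establishes its own hypothesis (the output again admits a mass function with summable columns and totals), so it ITERATES along the `k`-fold transport of
# `GAN24/BlockFluxTower` — the currency in which the tower CONTRACTS level-free whenever `g_j < 1` («total flux decays» of RULING R-g29-2 (1), as a theorem shape;
# constants displayed); sequel of `GAN24/BlockFluxMass` + `GAN24/BlockFluxTower`; G-an2-4 formalisation swarm → CRUX TEAM (2), leaf prover
# `b2b-balaban-gan24-formalise-leaf-03`, gen 62, programme «FLUX-REC» PART 6; module name PROVISIONAL — the row owner gan24-p1 may rename ∕ re-home it)

NOT IN PRINT; OUR BOOKKEEPING.  HONEST FRAMING (cell contract, verbatim): «discharging `BetaPertH` makes Bałaban's UV stability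
UNCONDITIONAL — a real constructive-QFT result; it is NOT the continuum limit and NOT the Clay problem.»  HONEST DEPENDENCY (verbatim):
«continuum YM on T⁴ ⇐ BetaPertH ∧ nine spine estimates (0/9 proved); BetaPertH ⇐ (D1) ∧ (D4) ∧ CAP+tail; G-an2-4 gates asym, D1 and
NE2/3/4.»

WHAT ([folklore] `Mathlib`'s `summable_of_sum_le ∕ Real.tsum_le_of_sum_le` (nonnegative families with bounded partial sums), `Summable.tsum_finsetSum`, over PART 5
`BlockFluxMass.finsetSum_abs_smul_mmRead_sandwich_le_mass` and PART 2 `BlockFluxTower.regionSum_divV_transport`; generic `d`; 0 `def`, 0 cite, 0 `def … : Prop`, 0 sorry).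
The «mass function» of a kernel `V` is written out each time: `0 ≤ μ`, `|V y w f g| ≤ μ y w`, `∀ w, Summable (μ · w)`, `Summable (w ↦ Σ'_y μ y w)`, total `Σ'_w Σ'_y μ y w`.
* §0 (leaf-01 g67 W-2's normal form, journal 2026-08-22T18:18Z) **`finsetSum_abs_sandwich_le_mass_weight`** — PART 5's ℓ¹ gain with the legs windowed by
  COARSE-SUMMABLE WEIGHTS `E, E′` (`|K (N•x′) p a f| ≤ h_L·E x′ p`, `Σ_{x′∈Fx} E x′ p ≤ Z_E` for all finite `Fx` — e.g. (N1)'s block-label profile, `Z_E = Z_{κ₀}`):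
  `Σ_{x′∈Fx} Σ_{z′∈Fz} |(K∘V∘K)(N•x′)(N•z′) a b| ≤ |Fib d|²·h_L·h_R·Z_E·Z_E′·M₁` — NO dilation loss (the fine-distance form of PART 5 bounds dilated sums by the full `Z_δ`).
* §1 `summable_col_of_sum_prod_le ∕ tsum_cols_le_of_sum_prod_le` — a nonnegative two-index family with partial sums over products of finite sets `≤ c` has summable
  columns, summable column totals, and total `≤ c`.
* §2 **`exists_mass_smul_mmRead_sandwich`** — THE ONE-LEVEL GAIN RE-ESTABLISHES ITS HYPOTHESIS: the output `c • mmRead N (K ∘ V ∘ K)` admits the mass function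
  `μ′ x′ z′ := Σ_{a b} |(c • mmRead N (K∘V∘K)) x′ z′ a b|` with total `≤ |Fib d|²·(|c|·|Fib d|²·C²·Z_δ²·M₁)`.
* §3 **`exists_mass_regionSum_divV_transport`** — THE TOWER: for decaying `K_j` (constants `C_j`, rates `δ_j > 0`), `N ≥ 1`, scalars `c_j`, bounded `S`, (hH)_j: if the bottom
  letter's flux through `U_{N^k}(T)` admits a mass function of total `M₁`, the flux of `transport (j S ↦ c_j • e3OfK N K_j S) m k S` through `T` admits one of total
  `≤ (∏_{i<k} |Fib d|²·(|c_{m+i}·c_{H,m+i}|·|Fib d|²·C_{m+i}²·Z_{δ_{m+i}}²))·M₁`.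

LOCATED CAVEAT: as in PART 5 — total mass is not the END's `BiLoc` reading; no value of the literal's `C_j, δ_j` is asserted; the `|Fib d|⁴` is bookkeeping slack (entrywise
mass vs leg sums), not physics.  Decides nothing about (Q-R) ∕ (DIV) ∕ (DL) ∕ K-LL-4′; NOTHING of (LT) ∕ (LAY) ∕ (S) ∕ «T2Shape» ∕ «T2Drift» ∕ (hW, hWall) discharged; 0 wall
binders; NEVER «G-an2-4 closed» as (CONV-C); NOT D1, NOT `BetaPertH`, NOT continuum, NOT Clay; not in print — our bookkeeping.  Unit `b2b-balaban-gan24-formalise-leaf-03`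
(gen 62), 2026-08-22.
-/

noncomputable section

open Finset
open scoped BigOperators
open Literature.MathematicalPhysics.QuantumFieldTheory
open Literature.MathematicalPhysics.QuantumFieldTheory.Balaban1983to89
open Literature.MathematicalPhysics.QuantumFieldTheory.Balaban1983to89.Beta
open B6BondElimination (unitVec)
open ExpKernelCalculus (MKer Site Decays comp Zl Zl_nonneg)
open OneStepResolventKernel (Fib)
open OneStepKernelFamily (colH)
open BalabanStepJetsSucc (mmRead)
open KernelWard (divV Bdd)
open AffineAveraging (box toSite)
open Summit.QuantumFields.BalabanUV.Beta.KernelWardRelative (gaugeWt)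
open Summit.QuantumFields.BalabanUV.Beta.SpineRooted (e3OfK)
open Summit.QuantumFields.BalabanUV.Beta.GAN24.AffineUnroll (transport transport_zero transport_succ)
open Summit.QuantumFields.BalabanUV.Beta.GAN24.E3SlotDivergence (divV_smul_family)
open Summit.QuantumFields.BalabanUV.Beta.GAN24.LayerLetterUnion (biUnion_box_image_eq)
open Summit.QuantumFields.BalabanUV.Beta.GAN24.BlockFluxRegion (regionSum_divV_e3OfK)
open Summit.QuantumFields.BalabanUV.Beta.GAN24.BlockFluxTower (exists_bdd_transport regionSum_divV_transport)
open Summit.QuantumFields.BalabanUV.Beta.GAN24.BlockFluxMass (finsetSum_abs_smul_mmRead_sandwich_le_mass)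

namespace Summit.QuantumFields.BalabanUV.Beta.GAN24.BlockFluxMassTower

variable {d N : ℕ}

/-! ## §0 Coarse-weight (block-label) currency: PART 5's one-level gain with the legs windowed by coarse-summable weights — no dilation loss -/

section Weighted

variable {K V : MKer (d + 1) (Fib d)} {μ : Site (d + 1) → Site (d + 1) → ℝ} {E E' : Site (d + 1) → Site (d + 1) → ℝ} {hL hR ZE ZE' : ℝ}

/-- [folklore] `y ↦ E x′ y · μ y w` is summable (`0 ≤ E ≤ 1`, summable column). -/
theorem summable_weight_mul_mass (hE0 : ∀ x p, 0 ≤ E x p) (hE1 : ∀ x p, E x p ≤ 1) (hμ0 : ∀ y w, 0 ≤ μ y w) (hμy : ∀ w, Summable fun y => μ y w)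
    (x' w : Site (d + 1)) : Summable fun y => E x' y * μ y w :=
  Summable.of_nonneg_of_le (fun y => mul_nonneg (hE0 x' y) (hμ0 y w)) (fun y => mul_le_of_le_one_left (hμ0 y w) (hE1 x' y)) (hμy w)

/-- [folklore] … and is at most the column total. -/
theorem tsum_weight_mul_mass_le (hE0 : ∀ x p, 0 ≤ E x p) (hE1 : ∀ x p, E x p ≤ 1) (hμ0 : ∀ y w, 0 ≤ μ y w) (hμy : ∀ w, Summable fun y => μ y w)
    (x' w : Site (d + 1)) : ∑' y, E x' y * μ y w ≤ ∑' y, μ y w :=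
  (summable_weight_mul_mass hE0 hE1 hμ0 hμy x' w).tsum_le_tsum (fun y => mul_le_of_le_one_left (hμ0 y w) (hE1 x' y)) (hμy w)

/-- [folklore] `|(K ∘ V) (N•x′) w a g| ≤ |Fib d|·h_L·Σ'_y E x′ y·μ y w` for a left leg windowed by the coarse weight `E` (e.g. (N1)'s block-label profile). -/
theorem abs_comp_le_mass_weight (hE0 : ∀ x p, 0 ≤ E x p) (hE1 : ∀ x p, E x p ≤ 1) (hhL : 0 ≤ hL)
    (hKL : ∀ (x' p : Site (d + 1)) (a f : Fib d), |K ((N : ℤ) • x') p a f| ≤ hL * E x' p)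
    (hμ0 : ∀ y w, 0 ≤ μ y w) (hVμ : ∀ y w f g, |V y w f g| ≤ μ y w) (hμy : ∀ w, Summable fun y => μ y w)
    (x' w : Site (d + 1)) (a g : Fib d) :
    |comp K V ((N : ℤ) • x') w a g| ≤ (Fintype.card (Fib d) : ℝ) * (hL * ∑' y, E x' y * μ y w) := by
  unfold ExpKernelCalculus.comp
  have hs := summable_weight_mul_mass hE0 hE1 hμ0 hμy x' w
  have hmaj := (hs.mul_left hL).mul_left (Fintype.card (Fib d) : ℝ)
  have hb := tsum_of_norm_bounded hmaj.hasSum (fun y => by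
    rw [Real.norm_eq_abs]
    calc |∑ f, K ((N : ℤ) • x') y a f * V y w f g| ≤ ∑ f, |K ((N : ℤ) • x') y a f * V y w f g| := Finset.abs_sum_le_sum_abs _ _
      _ ≤ ∑ _f : Fib d, hL * E x' y * μ y w := Finset.sum_le_sum fun f _ => by
          rw [abs_mul]
          exact mul_le_mul (hKL x' y a f) (hVμ y w f g) (abs_nonneg _) (mul_nonneg hhL (hE0 x' y))
      _ = (Fintype.card (Fib d) : ℝ) * (hL * (E x' y * μ y w)) := by
          rw [Finset.sum_const, Finset.card_univ, nsmul_eq_mul]; ring)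
  rw [Real.norm_eq_abs] at hb
  refine hb.trans (le_of_eq ?_)
  rw [tsum_mul_left, tsum_mul_left]

/-- [folklore] `w ↦ (Σ'_y E x′ y μ y w)·E′ w z′` is summable. -/
theorem summable_mass_col_weight (hE0 : ∀ x p, 0 ≤ E x p) (hE1 : ∀ x p, E x p ≤ 1) (hE'0 : ∀ q z, 0 ≤ E' q z) (hE'1 : ∀ q z, E' q z ≤ 1)
    (hμ0 : ∀ y w, 0 ≤ μ y w) (hμy : ∀ w, Summable fun y => μ y w) (hμw : Summable fun w => ∑' y, μ y w) (x' z' : Site (d + 1)) :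
    Summable fun w => (∑' y, E x' y * μ y w) * E' w z' := by
  refine Summable.of_nonneg_of_le (fun w => mul_nonneg (tsum_nonneg fun y => mul_nonneg (hE0 x' y) (hμ0 y w)) (hE'0 w z')) (fun w => ?_) hμw
  calc (∑' y, E x' y * μ y w) * E' w z' ≤ (∑' y, E x' y * μ y w) * 1 :=
        mul_le_mul_of_nonneg_left (hE'1 w z') (tsum_nonneg fun y => mul_nonneg (hE0 x' y) (hμ0 y w))
    _ ≤ ∑' y, μ y w := by rw [mul_one]; exact tsum_weight_mul_mass_le hE0 hE1 hμ0 hμy x' w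

/-- [folklore] `|(K ∘ V ∘ K) (N•x′) (N•z′) a b| ≤ |Fib d|²·h_L·h_R·Σ'_w (Σ'_y E x′ y μ y w)·E′ w z′`. -/
theorem abs_sandwich_le_mass_weight (hE0 : ∀ x p, 0 ≤ E x p) (hE1 : ∀ x p, E x p ≤ 1) (hE'0 : ∀ q z, 0 ≤ E' q z) (hE'1 : ∀ q z, E' q z ≤ 1)
    (hhL : 0 ≤ hL)
    (hKL : ∀ (x' p : Site (d + 1)) (a f : Fib d), |K ((N : ℤ) • x') p a f| ≤ hL * E x' p)
    (hKR : ∀ (q z' : Site (d + 1)) (f b : Fib d), |K q ((N : ℤ) • z') f b| ≤ hR * E' q z')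
    (hμ0 : ∀ y w, 0 ≤ μ y w) (hVμ : ∀ y w f g, |V y w f g| ≤ μ y w) (hμy : ∀ w, Summable fun y => μ y w)
    (hμw : Summable fun w => ∑' y, μ y w) (x' z' : Site (d + 1)) (a b : Fib d) :
    |comp (comp K V) K ((N : ℤ) • x') ((N : ℤ) • z') a b|
      ≤ (Fintype.card (Fib d) : ℝ) * ((Fintype.card (Fib d) : ℝ) * (hL * hR))
          * ∑' w, (∑' y, E x' y * μ y w) * E' w z' := by
  have hs := summable_mass_col_weight hE0 hE1 hE'0 hE'1 hμ0 hμy hμw x' z'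
  unfold ExpKernelCalculus.comp
  have hmaj := hs.mul_left ((Fintype.card (Fib d) : ℝ) * ((Fintype.card (Fib d) : ℝ) * (hL * hR)))
  have hb := tsum_of_norm_bounded hmaj.hasSum (fun w => by
    rw [Real.norm_eq_abs]
    calc |∑ g, (∑' y, ∑ f, K ((N : ℤ) • x') y a f * V y w f g) * K w ((N : ℤ) • z') g b|
        ≤ ∑ g, |(∑' y, ∑ f, K ((N : ℤ) • x') y a f * V y w f g) * K w ((N : ℤ) • z') g b| := Finset.abs_sum_le_sum_abs _ _
      _ ≤ ∑ _g : Fib d, ((Fintype.card (Fib d) : ℝ) * (hL * ∑' y, E x' y * μ y w)) * (hR * E' w z') :=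
          Finset.sum_le_sum fun g _ => by
            rw [abs_mul]
            have h1 := abs_comp_le_mass_weight (N := N) hE0 hE1 hhL hKL hμ0 hVμ hμy x' w a g
            unfold ExpKernelCalculus.comp at h1
            exact mul_le_mul h1 (hKR w z' g b) (abs_nonneg _)
              (mul_nonneg (Nat.cast_nonneg _) (mul_nonneg hhL (tsum_nonneg fun y => mul_nonneg (hE0 x' y) (hμ0 y w))))
      _ = (Fintype.card (Fib d) : ℝ) * ((Fintype.card (Fib d) : ℝ) * (hL * hR)) * ((∑' y, E x' y * μ y w) * E' w z') := by
          rw [Finset.sum_const, Finset.card_univ, nsmul_eq_mul]; ring)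
  rw [Real.norm_eq_abs] at hb
  refine hb.trans (le_of_eq ?_)
  rw [tsum_mul_left]

/-- [folklore] **THE ℓ¹ → ℓ¹ GAIN IN COARSE-WEIGHT CURRENCY — NO DILATION LOSS**: if the coarse sums of the weights are bounded (`Σ_{x′∈Fx} E x′ p ≤ Z_E`,
`Σ_{z′∈Fz} E′ q z′ ≤ Z_E′` for all finite sets — e.g. `Z_{κ₀}` for (N1)'s block-label profile), then
`Σ_{x′∈Fx} Σ_{z′∈Fz} |(K ∘ V ∘ K) (N•x′) (N•z′) a b| ≤ |Fib d|²·h_L·h_R·Z_E·Z_E′·M₁` — leaf-01 g67 W-2's normal form: the VALUE `A²·Z_{κ₀}²·Lc^{−2}` of R-1 (iii) comes out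
when `h_L = h_R = A·(Lc^{d+2})⁻¹` and the END weight `Lc^{2(d+1)}` are inserted (not asserted here). -/
theorem finsetSum_abs_sandwich_le_mass_weight (hE0 : ∀ x p, 0 ≤ E x p) (hE1 : ∀ x p, E x p ≤ 1) (hE'0 : ∀ q z, 0 ≤ E' q z)
    (hE'1 : ∀ q z, E' q z ≤ 1) (hhL : 0 ≤ hL) (hhR : 0 ≤ hR)
    (hKL : ∀ (x' p : Site (d + 1)) (a f : Fib d), |K ((N : ℤ) • x') p a f| ≤ hL * E x' p)
    (hKR : ∀ (q z' : Site (d + 1)) (f b : Fib d), |K q ((N : ℤ) • z') f b| ≤ hR * E' q z')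
    (hZE : ∀ (p : Site (d + 1)) (Fx : Finset (Site (d + 1))), ∑ x' ∈ Fx, E x' p ≤ ZE)
    (hZE' : ∀ (q : Site (d + 1)) (Fz : Finset (Site (d + 1))), ∑ z' ∈ Fz, E' q z' ≤ ZE')
    (hμ0 : ∀ y w, 0 ≤ μ y w) (hVμ : ∀ y w f g, |V y w f g| ≤ μ y w) (hμy : ∀ w, Summable fun y => μ y w)
    (hμw : Summable fun w => ∑' y, μ y w) (Fx Fz : Finset (Site (d + 1))) (a b : Fib d) :
    ∑ x' ∈ Fx, ∑ z' ∈ Fz, |comp (comp K V) K ((N : ℤ) • x') ((N : ℤ) • z') a b|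
      ≤ (Fintype.card (Fib d) : ℝ) * ((Fintype.card (Fib d) : ℝ) * (hL * hR)) * ZE' * (ZE * ∑' w, ∑' y, μ y w) := by
  have hZE0 : 0 ≤ ZE := le_trans (by simp) (hZE 0 ∅)
  have hZE'0 : 0 ≤ ZE' := le_trans (by simp) (hZE' 0 ∅)
  have hcard : 0 ≤ (Fintype.card (Fib d) : ℝ) * ((Fintype.card (Fib d) : ℝ) * (hL * hR)) := by positivity
  have hP0 : ∀ x' w, 0 ≤ ∑' y, E x' y * μ y w := fun x' w => tsum_nonneg fun y => mul_nonneg (hE0 x' y) (hμ0 y w)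
  have hPs : ∀ x', Summable fun w => ∑' y, E x' y * μ y w := fun x' =>
    Summable.of_nonneg_of_le (hP0 x') (fun w => tsum_weight_mul_mass_le hE0 hE1 hμ0 hμy x' w) hμw
  -- one row: the finite sum over `z′` inside the series over `w`, then `hZE′`
  have hrow : ∀ x', ∑ z' ∈ Fz, |comp (comp K V) K ((N : ℤ) • x') ((N : ℤ) • z') a b|
      ≤ (Fintype.card (Fib d) : ℝ) * ((Fintype.card (Fib d) : ℝ) * (hL * hR)) * ZE' * ∑' w, ∑' y, E x' y * μ y w := by
    intro x'
    have h1 : ∑ z' ∈ Fz, |comp (comp K V) K ((N : ℤ) • x') ((N : ℤ) • z') a b|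
        ≤ ∑ z' ∈ Fz, (Fintype.card (Fib d) : ℝ) * ((Fintype.card (Fib d) : ℝ) * (hL * hR)) * ∑' w, (∑' y, E x' y * μ y w) * E' w z' :=
      Finset.sum_le_sum fun z' _ => abs_sandwich_le_mass_weight hE0 hE1 hE'0 hE'1 hhL hKL hKR hμ0 hVμ hμy hμw x' z' a b
    refine h1.trans ?_
    rw [← Finset.mul_sum]
    have key : ∑ z' ∈ Fz, ∑' w, (∑' y, E x' y * μ y w) * E' w z' ≤ ZE' * ∑' w, ∑' y, E x' y * μ y w := by
      rw [← Summable.tsum_finsetSum (fun z' _ => summable_mass_col_weight hE0 hE1 hE'0 hE'1 hμ0 hμy hμw x' z'), ← tsum_mul_left]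
      refine (summable_sum fun z' _ => summable_mass_col_weight hE0 hE1 hE'0 hE'1 hμ0 hμy hμw x' z').tsum_le_tsum (fun w => ?_)
        ((hPs x').mul_left _)
      rw [← Finset.mul_sum, mul_comm ZE']
      exact mul_le_mul_of_nonneg_left (hZE' w Fz) (hP0 x' w)
    calc (Fintype.card (Fib d) : ℝ) * ((Fintype.card (Fib d) : ℝ) * (hL * hR)) * ∑ z' ∈ Fz, ∑' w, (∑' y, E x' y * μ y w) * E' w z'
        ≤ (Fintype.card (Fib d) : ℝ) * ((Fintype.card (Fib d) : ℝ) * (hL * hR)) * (ZE' * ∑' w, ∑' y, E x' y * μ y w) :=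
          mul_le_mul_of_nonneg_left key hcard
      _ = _ := by ring
  -- all rows: the finite sum over `x′` inside both series, then `hZE`
  have hcol : ∑ x' ∈ Fx, ∑' w, ∑' y, E x' y * μ y w ≤ ZE * ∑' w, ∑' y, μ y w := by
    rw [← Summable.tsum_finsetSum (fun x' _ => hPs x'), ← tsum_mul_left]
    refine (summable_sum fun x' _ => hPs x').tsum_le_tsum (fun w => ?_) (hμw.mul_left _)
    rw [← Summable.tsum_finsetSum (fun x' _ => summable_weight_mul_mass hE0 hE1 hμ0 hμy x' w), ← tsum_mul_left]
    refine (summable_sum fun x' _ => summable_weight_mul_mass hE0 hE1 hμ0 hμy x' w).tsum_le_tsum (fun y => ?_) ((hμy w).mul_left _)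
    rw [← Finset.sum_mul]
    exact mul_le_mul_of_nonneg_right (hZE y Fx) (hμ0 y w)
  calc ∑ x' ∈ Fx, ∑ z' ∈ Fz, |comp (comp K V) K ((N : ℤ) • x') ((N : ℤ) • z') a b|
      ≤ ∑ x' ∈ Fx, (Fintype.card (Fib d) : ℝ) * ((Fintype.card (Fib d) : ℝ) * (hL * hR)) * ZE' * ∑' w, ∑' y, E x' y * μ y w :=
        Finset.sum_le_sum fun x' _ => hrow x'
    _ = (Fintype.card (Fib d) : ℝ) * ((Fintype.card (Fib d) : ℝ) * (hL * hR)) * ZE' * ∑ x' ∈ Fx, ∑' w, ∑' y, E x' y * μ y w := by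
        rw [Finset.mul_sum]
    _ ≤ (Fintype.card (Fib d) : ℝ) * ((Fintype.card (Fib d) : ℝ) * (hL * hR)) * ZE' * (ZE * ∑' w, ∑' y, μ y w) :=
        mul_le_mul_of_nonneg_left hcol (mul_nonneg hcard hZE'0)

end Weighted

/-! ## §1 From bounded product partial sums to summable columns and totals -/

/-- [folklore] A nonnegative two-index family whose partial sums over products of finite sets are `≤ c` has SUMMABLE COLUMNS (`Fz = {z}`). -/
theorem summable_col_of_sum_prod_le {out : Site (d + 1) → Site (d + 1) → ℝ} (h0 : ∀ x z, 0 ≤ out x z) {c : ℝ}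
    (h : ∀ Fx Fz : Finset (Site (d + 1)), ∑ x ∈ Fx, ∑ z ∈ Fz, out x z ≤ c) (z : Site (d + 1)) : Summable fun x => out x z := by
  refine summable_of_sum_le (c := c) (fun x => h0 x z) (fun Fx => ?_)
  have h1 := h Fx {z}
  simpa only [Finset.sum_singleton] using h1

/-- [folklore] … and its COLUMN TOTALS are summable with total `≤ c` (the finite sum over columns goes inside the column series by `Summable.tsum_finsetSum`,
then `Real.tsum_le_of_sum_le` twice). -/
theorem tsum_cols_le_of_sum_prod_le {out : Site (d + 1) → Site (d + 1) → ℝ} (h0 : ∀ x z, 0 ≤ out x z) {c : ℝ}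
    (h : ∀ Fx Fz : Finset (Site (d + 1)), ∑ x ∈ Fx, ∑ z ∈ Fz, out x z ≤ c) :
    (Summable fun z => ∑' x, out x z) ∧ ∑' z, ∑' x, out x z ≤ c := by
  have hcol := summable_col_of_sum_prod_le h0 h
  have hpart : ∀ Fz : Finset (Site (d + 1)), ∑ z ∈ Fz, ∑' x, out x z ≤ c := by
    intro Fz
    rw [← Summable.tsum_finsetSum (fun z _ => hcol z)]
    exact Real.tsum_le_of_sum_le (fun x => Finset.sum_nonneg fun z _ => h0 x z) (fun Fx => h Fx Fz)
  have h0' : ∀ z, 0 ≤ ∑' x, out x z := fun z => tsum_nonneg fun x => h0 x z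
  exact ⟨summable_of_sum_le h0' hpart, Real.tsum_le_of_sum_le h0' hpart⟩

/-! ## §2 The one-level gain re-establishes its hypothesis -/

section OneLevel

variable {K V : MKer (d + 1) (Fib d)} {C δ : ℝ} {μ : Site (d + 1) → Site (d + 1) → ℝ}

/-- [folklore] **THE OUTPUT OF THE FLUX MAP AGAIN ADMITS A MASS FUNCTION** (PART 5's gain iterates): for `Decays K C δ` (`δ > 0`), `N ≥ 1`, and an input `V` with mass function
`μ` (total `M₁ = Σ'_w Σ'_y μ y w`), the output `V′ := c • mmRead N (K ∘ V ∘ K)` is dominated entrywise by `μ′ x′ z′ := Σ_{a b} |V′ x′ z′ a b| ≥ 0`, whose columns and column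
totals are summable, with TOTAL MASS `Σ'_z′ Σ'_x′ μ′ x′ z′ ≤ |Fib d|²·(|c|·(|Fib d|²·C²·Z_δ·(Z_δ·M₁)))` — kernel-only, no refinement multiplicity, no rate rescaling. -/
theorem exists_mass_smul_mmRead_sandwich (hK : Decays K C δ) (hδ : 0 < δ) (hN : 1 ≤ N) (hμ0 : ∀ y w, 0 ≤ μ y w)
    (hVμ : ∀ y w f g, |V y w f g| ≤ μ y w) (hμy : ∀ w, Summable fun y => μ y w) (hμw : Summable fun w => ∑' y, μ y w) (c : ℝ) :
    ∃ μ' : Site (d + 1) → Site (d + 1) → ℝ,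
      (∀ x z, 0 ≤ μ' x z) ∧ (∀ x z a b, |(c • mmRead N (comp (comp K V) K)) x z a b| ≤ μ' x z) ∧ (∀ z, Summable fun x => μ' x z) ∧
        (Summable fun z => ∑' x, μ' x z) ∧
        ∑' z, ∑' x, μ' x z ≤ ((Fintype.card (Fib d) : ℝ) * (Fintype.card (Fib d) : ℝ)) *
          (|c| * ((Fintype.card (Fib d) : ℝ) * ((Fintype.card (Fib d) : ℝ) * (C * C)) * Zl (d + 1) δ * (Zl (d + 1) δ * ∑' w, ∑' y, μ y w))) := by
  set out : Site (d + 1) → Site (d + 1) → ℝ :=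
    fun x z => ∑ p : Fib d × Fib d, |(c • mmRead N (comp (comp K V) K)) x z p.1 p.2| with hout
  have h0 : ∀ x z, 0 ≤ out x z := fun x z => Finset.sum_nonneg fun p _ => abs_nonneg _
  have hdom : ∀ x z a b, |(c • mmRead N (comp (comp K V) K)) x z a b| ≤ out x z := by
    intro x z a b
    exact Finset.single_le_sum (f := fun p : Fib d × Fib d => |(c • mmRead N (comp (comp K V) K)) x z p.1 p.2|)
      (fun _ _ => abs_nonneg _) (Finset.mem_univ (a, b))
  -- the product partial sums of `out` are bounded by PART 5, leg pair by leg pair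
  have hsum : ∀ Fx Fz : Finset (Site (d + 1)), ∑ x ∈ Fx, ∑ z ∈ Fz, out x z
      ≤ ((Fintype.card (Fib d) : ℝ) * (Fintype.card (Fib d) : ℝ)) *
          (|c| * ((Fintype.card (Fib d) : ℝ) * ((Fintype.card (Fib d) : ℝ) * (C * C)) * Zl (d + 1) δ * (Zl (d + 1) δ * ∑' w, ∑' y, μ y w))) := by
    intro Fx Fz
    have e : ∑ x ∈ Fx, ∑ z ∈ Fz, out x z = ∑ p : Fib d × Fib d, ∑ x ∈ Fx, ∑ z ∈ Fz, |(c • mmRead N (comp (comp K V) K)) x z p.1 p.2| := by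
      simp only [hout]
      rw [Finset.sum_congr rfl (fun x _ => Finset.sum_comm), Finset.sum_comm]
    rw [e]
    calc ∑ p : Fib d × Fib d, ∑ x ∈ Fx, ∑ z ∈ Fz, |(c • mmRead N (comp (comp K V) K)) x z p.1 p.2|
        ≤ ∑ _p : Fib d × Fib d, |c| * ((Fintype.card (Fib d) : ℝ) * ((Fintype.card (Fib d) : ℝ) * (C * C)) * Zl (d + 1) δ
            * (Zl (d + 1) δ * ∑' w, ∑' y, μ y w)) :=
          Finset.sum_le_sum fun p _ => finsetSum_abs_smul_mmRead_sandwich_le_mass hK hδ hN hμ0 hVμ hμy hμw c Fx Fz p.1 p.2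
      _ = _ := by rw [Finset.sum_const, Finset.card_univ, Fintype.card_prod, nsmul_eq_mul, Nat.cast_mul]
  obtain ⟨hs, ht⟩ := tsum_cols_le_of_sum_prod_le h0 hsum
  exact ⟨out, h0, hdom, summable_col_of_sum_prod_le h0 hsum, hs, ht⟩

end OneLevel

/-! ## §3 The tower in total-mass currency -/

section Tower

variable {K : ℕ → MKer (d + 1) (Fib d)} {C δ : ℕ → ℝ} {c cH : ℕ → ℝ}
  {S : Fin (d + 1) → (Fin (d + 1) → ℤ) → MKer (d + 1) (Fib d)} {B : ℝ}

/-- [folklore] **THE FLUX TOWER IN TOTAL MASS**: for decaying kernels `K_j` (constants `C_j`, rates `δ_j > 0`), `N ≥ 1`, scalars `c_j`, a bounded bottom letter `S`, (hH)_j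
with `c_{H,j}`, every `m, k` and finite `T`: if the bottom letter's flux through `U_{N^k}(T)` admits a mass function `μ` with total `M₁ = Σ'_w Σ'_y μ y w`, then the flux of
`transport (j S ↦ c_j • e3OfK N K_j S) m k S` through `T` admits a mass function of total `≤ (∏_{i<k} g_{m+i})·M₁`,
`g_j := |Fib d|²·|c_j·c_{H,j}|·|Fib d|²·C_j²·Z_{δ_j}²` — each level ONE kernel-only scalar; the tower's total flux mass CONTRACTS level-free whenever every `g_j < 1`. -/
theorem exists_mass_regionSum_divV_transport (hK : ∀ j, Decays (K j) (C j) (δ j)) (hδ : ∀ j, 0 < δ j) (hN : 1 ≤ N)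
    (hS : ∀ κ u x z a b, |S κ u x z a b| ≤ B)
    (hH : ∀ (j : ℕ) (y : Fin (d + 1) → ℤ) (κ' : Fin (d + 1)) (u : Fin (d + 1) → ℤ),
      ∑ μ', (colH (K j) N μ' (y - unitVec μ') κ' u - colH (K j) N μ' y κ' u) = cH j * gaugeWt N y κ' u)
    (m : ℕ) : ∀ (k : ℕ) (T : Finset (Site (d + 1))) (μ : Site (d + 1) → Site (d + 1) → ℝ),
    (∀ y w, 0 ≤ μ y w) →
    (∀ y w f g, |(∑ u ∈ T.biUnion (fun Y => (box (d + 1) (N ^ k)).image (fun v => ((N ^ k : ℕ) : ℤ) • Y + toSite v)), divV S u) y w f g| ≤ μ y w) →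
    (∀ w, Summable fun y => μ y w) → (Summable fun w => ∑' y, μ y w) →
    ∃ μ' : Site (d + 1) → Site (d + 1) → ℝ,
      (∀ x z, 0 ≤ μ' x z) ∧ (∀ x z a b, |(∑ Y ∈ T, divV (transport (fun j S => c j • e3OfK N (K j) S) m k S) Y) x z a b| ≤ μ' x z) ∧
        (∀ z, Summable fun x => μ' x z) ∧ (Summable fun z => ∑' x, μ' x z) ∧
        ∑' z, ∑' x, μ' x z ≤ (∏ i ∈ Finset.range k, (((Fintype.card (Fib d) : ℝ) * (Fintype.card (Fib d) : ℝ)) *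
          (|c (m + i) * cH (m + i)| * (((Fintype.card (Fib d) : ℝ) * ((Fintype.card (Fib d) : ℝ) * (C (m + i) * C (m + i))))
            * Zl (d + 1) (δ (m + i)) * Zl (d + 1) (δ (m + i)))))) * ∑' w, ∑' y, μ y w
  | 0, T, μ, hμ0, hVμ, hμy, hμw => by
    refine ⟨μ, hμ0, fun x z a b => ?_, hμy, hμw, by rw [Finset.prod_range_zero, one_mul]⟩
    rw [regionSum_divV_transport hK hδ hN hS hH m 0 T, transport_zero]
    exact hVμ x z a b
  | k + 1, T, μ, hμ0, hVμ, hμy, hμw => by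
    classical
    obtain ⟨B', hB'⟩ := exists_bdd_transport hK hδ c N hS m k
    have hNk : 1 ≤ N ^ k := Nat.one_le_pow _ _ (Nat.pos_of_ne_zero (Nat.one_le_iff_ne_zero.1 hN))
    have e2 : (T.biUnion (fun Y => (box (d + 1) N).image (fun v => (N : ℤ) • Y + toSite v))).biUnion
          (fun Y' => (box (d + 1) (N ^ k)).image (fun v => ((N ^ k : ℕ) : ℤ) • Y' + toSite v))
        = T.biUnion (fun Y => (box (d + 1) (N ^ (k + 1))).image (fun s => ((N ^ (k + 1) : ℕ) : ℤ) • Y + toSite s)) := by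
      rw [Finset.biUnion_biUnion]
      refine Finset.biUnion_congr rfl fun Y _ => ?_
      rw [pow_succ]
      exact biUnion_box_image_eq hNk N Y
    -- the hypothesis on the refined region `U_N(T)`
    have hVμ' : ∀ y w f g, |(∑ u ∈ (T.biUnion (fun Y => (box (d + 1) N).image (fun v => (N : ℤ) • Y + toSite v))).biUnion
        (fun Y' => (box (d + 1) (N ^ k)).image (fun v => ((N ^ k : ℕ) : ℤ) • Y' + toSite v)), divV S u) y w f g| ≤ μ y w := by
      rw [e2]; exact hVμ
    obtain ⟨μ₁, h10, h1dom, h1y, h1w, h1tot⟩ := exists_mass_regionSum_divV_transport hK hδ hN hS hH m k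
      (T.biUnion (fun Y => (box (d + 1) N).image (fun v => (N : ℤ) • Y + toSite v))) μ hμ0 hVμ' hμy hμw
    -- the top level: the identity, the scalar, and §2
    have e1 : ∑ Y ∈ T, divV (c (m + k) • e3OfK N (K (m + k)) (transport (fun j S => c j • e3OfK N (K j) S) m k S)) Y
        = c (m + k) • ∑ Y ∈ T, divV (e3OfK N (K (m + k)) (transport (fun j S => c j • e3OfK N (K j) S) m k S)) Y := by
      rw [Finset.smul_sum]
      exact Finset.sum_congr rfl fun Y _ => divV_smul_family _ _ Y
    have etop : ∑ Y ∈ T, divV (transport (fun j S => c j • e3OfK N (K j) S) m (k + 1) S) Y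
        = (-(c (m + k) * cH (m + k))) • mmRead N (comp (comp (K (m + k))
            (∑ u ∈ T.biUnion (fun Y => (box (d + 1) N).image (fun v => (N : ℤ) • Y + toSite v)),
              divV (transport (fun j S => c j • e3OfK N (K j) S) m k S) u)) (K (m + k))) := by
      simp only [transport_succ]
      rw [e1, regionSum_divV_e3OfK (hK (m + k)) (hδ (m + k)) hN hB' (hH (m + k)) T, smul_neg, smul_smul, ← neg_smul]
    obtain ⟨μ', h0', hdom', hy', hw', htot'⟩ :=
      exists_mass_smul_mmRead_sandwich (N := N) (hK (m + k)) (hδ (m + k)) hN h10 h1dom h1y h1w (-(c (m + k) * cH (m + k)))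
    refine ⟨μ', h0', fun x z a b => ?_, hy', hw', ?_⟩
    · rw [etop]; exact hdom' x z a b
    · rw [abs_neg] at htot'
      refine htot'.trans ?_
      rw [Finset.prod_range_succ]
      have hg : 0 ≤ ((Fintype.card (Fib d) : ℝ) * (Fintype.card (Fib d) : ℝ)) *
          (|c (m + k) * cH (m + k)| * (((Fintype.card (Fib d) : ℝ) * ((Fintype.card (Fib d) : ℝ) * (C (m + k) * C (m + k))))
            * Zl (d + 1) (δ (m + k)) * Zl (d + 1) (δ (m + k)))) := by
        have hC : 0 ≤ C (m + k) := (hK (m + k)).nonneg (Sum.inl 0)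
        have hZ : 0 ≤ Zl (d + 1) (δ (m + k)) := Zl_nonneg (hδ (m + k))
        positivity
      calc ((Fintype.card (Fib d) : ℝ) * (Fintype.card (Fib d) : ℝ)) * (|c (m + k) * cH (m + k)| * ((Fintype.card (Fib d) : ℝ)
              * ((Fintype.card (Fib d) : ℝ) * (C (m + k) * C (m + k))) * Zl (d + 1) (δ (m + k)) * (Zl (d + 1) (δ (m + k)) * ∑' z, ∑' x, μ₁ x z)))
          = (((Fintype.card (Fib d) : ℝ) * (Fintype.card (Fib d) : ℝ)) * (|c (m + k) * cH (m + k)| * (((Fintype.card (Fib d) : ℝ)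
              * ((Fintype.card (Fib d) : ℝ) * (C (m + k) * C (m + k)))) * Zl (d + 1) (δ (m + k)) * Zl (d + 1) (δ (m + k)))))
              * ∑' z, ∑' x, μ₁ x z := by ring
        _ ≤ (((Fintype.card (Fib d) : ℝ) * (Fintype.card (Fib d) : ℝ)) * (|c (m + k) * cH (m + k)| * (((Fintype.card (Fib d) : ℝ)
              * ((Fintype.card (Fib d) : ℝ) * (C (m + k) * C (m + k)))) * Zl (d + 1) (δ (m + k)) * Zl (d + 1) (δ (m + k)))))
              * ((∏ i ∈ Finset.range k, (((Fintype.card (Fib d) : ℝ) * (Fintype.card (Fib d) : ℝ)) *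
                (|c (m + i) * cH (m + i)| * (((Fintype.card (Fib d) : ℝ) * ((Fintype.card (Fib d) : ℝ) * (C (m + i) * C (m + i))))
                  * Zl (d + 1) (δ (m + i)) * Zl (d + 1) (δ (m + i)))))) * ∑' w, ∑' y, μ y w) :=
            mul_le_mul_of_nonneg_left h1tot hg
        _ = _ := by ring

end Tower

end Summit.QuantumFields.BalabanUV.Beta.GAN24.BlockFluxMassTower

end
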